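import Summits.CriticalPhenomena.PercolationContinuityZ3.Theorems.PercNearOneGluingNoHeavyLowerTailKnQuestion8CoefficientwiseHarrisTwice
import Summits.CriticalPhenomena.PercolationContinuityZ3.Theorems.PercNearOneGluingNoHeavyLowerTailKnQuestion8CoefficientwiseNoCoreNbhd
import Summits.CriticalPhenomena.PercolationContinuityZ3.Theorems.PercNearOneGluingNoHeavyLowerTailKnQuestion8CoefficientwiseNoCoreDegTwo
import HarnessLib

/-!
# The two-point exclusion `Q_mix(p,q)` when `q` (or `p`) is a leaf: reduction to the anchor — prim-lf-2 gen 50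

Support file (`--supports stmt-CriticalPhenomena-4575`, closed), prover `prim-lf-2` (gen 50).  No definitions, no named facts, no sorries; standard axioms.
Memo `prim-lf-2/CW-TWOSOURCE-gen50.md` §1; context `prim-lf-2/CW-QMIX-gen47.md`, `CW-HT-gen48.md` §3 (CONJECTURE Q_mix and the degree-two reduction of NO-CORE).

Setting.  Finite multigraph `ends : ι → Sym2 V`, root `x`, `K(s) = openCluster (ends '' s) x`, `f̂(s) = f(K s) − f(K sᶜ)`;
`Q_mix(p,q)[f,g] = Σ_{s : ¬(p ∈ K s ∧ q ∈ K sᶜ)} f̂ ĝ` (CONJECTURE Q_mix: `≥ 0` for monotone `f, g`; gen 48's `noCore_degTwo_nonneg_of_qmix` turns every settled pair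
`Q_mix(p,q), Q_mix(q,p)` on `G − y` into NO-CORE at a degree-two `y` with `N(y) = {p,q}`).
If `q ∉ {x, p}` is a LEAF with the single edge `e = qt` (`t ≠ q`) and `f, g` ignore `q`, resolving the colour of `e` gives the exact REDUCTION
  `Q_mix(p,q)[f,g] = Q_mix^{G−q}(p,t)[f,g] + H^{G−q}[f,g]`        (`qmix_leaf_snd_eq`)
(`e` blue: `q ∈ K sᶜ ⇔ t ∈ K′`, the exclusion becomes the one at the ANCHOR `t`; `e` red: `q ∉ K sᶜ`, no exclusion: the Harris sum of `G − q`), and symmetrically for a leaf `p`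
with anchor `t`: `Q_mix(p,q) = Q_mix^{G−q}(t,q) + H^{G−q}` (`qmix_leaf_fst_eq`).  Consequences (`H ≥ 0` is `harris_twoColouring`):
* `qmix_nonneg_of_leaf_snd` / `_fst` — `Q_mix(p,q) ≥ 0` as soon as the anchor pair is settled;
* `qmix_nonneg_of_leaf_snd_root` — anchor `t = x`: `Q_mix^{G−q}(p,x) = OFF^{G−q}(p) ≥ 0` (gen 23), so `Q_mix(p,q) ≥ 0` for every leaf `q` of the ROOT (the `f,g`-ignoring-`q` case of
  gen 47's `qmix_nonneg_of_rootPendant`, by a different route);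
* `qmix_nonneg_of_leaf_snd_point` — anchor `t` with `f = 1_t` ('the leaf hangs at the point'): `Q_mix(p,q)[1_t, g] ≥ 0` by Harris-twice (`qmix_nonneg_of_pointIndicator_right` on `G − q`).
Coverage (prim-lf-2 code/gen50/c/nccov50b.c): with these, the Lean-settled share of the NO-CORE point instances `(G,y)` rises from 99.3 % to 99.4 % at n = 7 (m ≤ 9; 2 592 new instances),
99.7 → 99.8 % at n = 6.
[cite: KozmaNitzan2024, Questions 8–9 (§5.5 p. 36) (context: the Question-8 pocket covariance programme)]
-/

namespace Summit.CriticalPhenomena.PercolationContinuityZ3.Theorems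

open Finset Literature.Probability.Percolation

namespace Coefficientwise

variable {ι V : Type*} [Fintype ι] [DecidableEq ι] (ends : ι → Sym2 V) (x : V)

omit [Fintype ι] in
/-- The power set of a singleton edge set. [cite: KozmaNitzan2024, §5.5 (context only; bookkeeping)] -/
theorem powerset_singleton_eq (e : ι) : ({e} : Finset ι).powerset = {∅, {e}} := by
  ext s
  rw [Finset.mem_powerset, Finset.subset_singleton_iff, Finset.mem_insert, Finset.mem_singleton]

section leaf

variable {p q t : V} {e : ι} (f g : Set V → ℝ)

open Classical in
/-- **Leaf reduction (second vertex).**  Let `q ∉ {x, p}` have exactly one edge `e`, with ends `{q, t}`, `t ≠ q`, and let `f, g` ignore `q`.  Then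
`Q_mix(p,q)[f,g] = Q_mix^{G−q}(p,t)[f,g] + H^{G−q}[f,g]`, the sums on the right over the cube of the multigraph with edge type `{j // j ∉ {e}}`.
[cite: KozmaNitzan2024, Questions 8–9 (§5.5 p. 36) (context)] -/
theorem qmix_leaf_snd_eq (he : ends e = s(q, t)) (htq : t ≠ q) (hxq : x ≠ q) (hpq : p ≠ q) (hdeg : ∀ i, q ∈ ends i → i = e)
    (hfq : ∀ C : Set V, f (insert q C) = f C) (hgq : ∀ C : Set V, g (insert q C) = g C) :
    ∑ s ∈ univ.filter (fun s : Finset ι => ¬ (p ∈ openCluster (ends '' (↑s : Set ι)) x ∧ q ∈ openCluster (ends '' (↑(sᶜ) : Set ι)) x)),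
      (f (openCluster (ends '' (↑s : Set ι)) x) - f (openCluster (ends '' (↑(sᶜ) : Set ι)) x)) *
        (g (openCluster (ends '' (↑s : Set ι)) x) - g (openCluster (ends '' (↑(sᶜ) : Set ι)) x)) =
    ∑ r ∈ univ.filter (fun r : Finset {j : ι // j ∉ ({e} : Finset ι)} =>
        ¬ (p ∈ openCluster ((fun j : {j : ι // j ∉ ({e} : Finset ι)} => ends j.1) '' (↑r : Set {j : ι // j ∉ ({e} : Finset ι)})) x ∧
           t ∈ openCluster ((fun j : {j : ι // j ∉ ({e} : Finset ι)} => ends j.1) '' (↑(rᶜ) : Set {j : ι // j ∉ ({e} : Finset ι)})) x)),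
      (f (openCluster ((fun j : {j : ι // j ∉ ({e} : Finset ι)} => ends j.1) '' (↑r : Set {j : ι // j ∉ ({e} : Finset ι)})) x) -
          f (openCluster ((fun j : {j : ι // j ∉ ({e} : Finset ι)} => ends j.1) '' (↑(rᶜ) : Set {j : ι // j ∉ ({e} : Finset ι)})) x)) *
        (g (openCluster ((fun j : {j : ι // j ∉ ({e} : Finset ι)} => ends j.1) '' (↑r : Set {j : ι // j ∉ ({e} : Finset ι)})) x) -
          g (openCluster ((fun j : {j : ι // j ∉ ({e} : Finset ι)} => ends j.1) '' (↑(rᶜ) : Set {j : ι // j ∉ ({e} : Finset ι)})) x))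
    + ∑ r : Finset {j : ι // j ∉ ({e} : Finset ι)},
      (f (openCluster ((fun j : {j : ι // j ∉ ({e} : Finset ι)} => ends j.1) '' (↑r : Set {j : ι // j ∉ ({e} : Finset ι)})) x) -
          f (openCluster ((fun j : {j : ι // j ∉ ({e} : Finset ι)} => ends j.1) '' (↑(rᶜ) : Set {j : ι // j ∉ ({e} : Finset ι)})) x)) *
        (g (openCluster ((fun j : {j : ι // j ∉ ({e} : Finset ι)} => ends j.1) '' (↑r : Set {j : ι // j ∉ ({e} : Finset ι)})) x) -
          g (openCluster ((fun j : {j : ι // j ∉ ({e} : Finset ι)} => ends j.1) '' (↑(rᶜ) : Set {j : ι // j ∉ ({e} : Finset ι)})) x)) := by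
  classical
  set D : Finset ι := {e} with hD
  set Pr : ι → Prop := fun j => j ∉ D with hPr
  set K : Finset ι → Set V := fun s => openCluster (ends '' (↑s : Set ι)) x with hK
  set emb := Function.Embedding.subtype Pr with hemb
  set K' : Finset {j : ι // Pr j} → Set V := fun r => openCluster ((fun j : {j : ι // Pr j} => ends j.1) '' (↑r : Set {j : ι // Pr j})) x with hK'
  have hKT : ∀ r : Finset {j : ι // Pr j}, K' r = K (r.map emb) := by
    intro r
    simp only [hK', hK, Finset.coe_map, Set.image_image]
    rfl
  have hnoT : ∀ r : Finset {j : ι // Pr j}, ∀ i ∈ r.map emb, q ∉ ends i := by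
    intro r i hi hqi
    obtain ⟨hP, _⟩ := (mem_map_subtype_iff Pr r i).mp hi
    have := hdeg i hqi
    subst this
    exact hP (by simp [hD])
  have pend : ∀ r : Finset {j : ι // Pr j},
      (∀ v, v ≠ q → (v ∈ K (insert e (r.map emb)) ↔ v ∈ K' r)) ∧ (q ∈ K (insert e (r.map emb)) ↔ t ∈ K' r) ∧ q ∉ K' r := by
    intro r; rw [hKT r]; exact openCluster_insert_leafEdge ends x (r.map emb) he htq hxq (hnoT r)
  -- resolve the colour of `e`
  rw [Finset.sum_filter, Finset.sum_filter]
  rw [sum_cube_eq_sum_powerset_subcube D (fun s s' =>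
      if ¬ (p ∈ openCluster (ends '' (↑s : Set ι)) x ∧ q ∈ openCluster (ends '' (↑s' : Set ι)) x) then
        (f (openCluster (ends '' (↑s : Set ι)) x) - f (openCluster (ends '' (↑s' : Set ι)) x)) *
          (g (openCluster (ends '' (↑s : Set ι)) x) - g (openCluster (ends '' (↑s' : Set ι)) x)) else 0)]
  rw [show D.powerset = {∅, {e}} from powerset_singleton_eq e, Finset.sum_pair (Finset.singleton_ne_empty e).symm]
  have h0 : D \ ∅ = {e} := by simp [hD]
  have h1 : D \ {e} = ∅ := by simp [hD]
  simp only [h0, h1, Finset.union_empty]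
  change ∑ r : Finset {j : ι // Pr j}, (if ¬ (p ∈ K (r.map emb) ∧ q ∈ K (rᶜ.map emb ∪ {e})) then
        (f (K (r.map emb)) - f (K (rᶜ.map emb ∪ {e}))) * (g (K (r.map emb)) - g (K (rᶜ.map emb ∪ {e}))) else 0)
    + ∑ r : Finset {j : ι // Pr j}, (if ¬ (p ∈ K (r.map emb ∪ {e}) ∧ q ∈ K (rᶜ.map emb)) then
        (f (K (r.map emb ∪ {e})) - f (K (rᶜ.map emb))) * (g (K (r.map emb ∪ {e})) - g (K (rᶜ.map emb))) else 0)
    = ∑ r : Finset {j : ι // Pr j}, (if ¬ (p ∈ K' r ∧ t ∈ K' rᶜ) then (f (K' r) - f (K' rᶜ)) * (g (K' r) - g (K' rᶜ)) else 0)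
    + ∑ r : Finset {j : ι // Pr j}, (f (K' r) - f (K' rᶜ)) * (g (K' r) - g (K' rᶜ))
  have hins : ∀ r : Finset {j : ι // Pr j}, r.map emb ∪ {e} = insert e (r.map emb) := by
    intro r; rw [Finset.union_comm, ← Finset.insert_eq]
  congr 1
  · refine Finset.sum_congr rfl fun r _ => ?_
    rw [hins rᶜ, ← hKT r]
    obtain ⟨a1, b1, c1⟩ := pend rᶜ
    have hpK : p ∈ K (insert e (rᶜ.map emb)) ↔ p ∈ K' rᶜ := a1 p hpq
    rw [apply_eq_of_agree_off f hfq a1 c1, apply_eq_of_agree_off g hgq a1 c1]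
    simp only [b1]
  · refine Finset.sum_congr rfl fun r _ => ?_
    rw [hins r, ← hKT rᶜ]
    obtain ⟨a1, b1, c1⟩ := pend r
    have hpK : p ∈ K (insert e (r.map emb)) ↔ p ∈ K' r := a1 p hpq
    have hqK : q ∉ K' rᶜ := (pend rᶜ).2.2
    rw [apply_eq_of_agree_off f hfq a1 c1, apply_eq_of_agree_off g hgq a1 c1]
    rw [if_pos (fun h => hqK h.2)]

open Classical in
/-- **Leaf reduction ⇒ positivity (second vertex).**  Under the hypotheses of `qmix_leaf_snd_eq`, for monotone `f, g`: if the anchor exclusion `Q_mix^{G−q}(p,t)[f,g]` is `≥ 0`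
then `Q_mix(p,q)[f,g] ≥ 0` (the other summand is the Harris two-colouring sum of `G − q`, `harris_twoColouring`).  [cite: KozmaNitzan2024, Questions 8–9 (§5.5 p. 36) (context)] -/
theorem qmix_nonneg_of_leaf_snd (he : ends e = s(q, t)) (htq : t ≠ q) (hxq : x ≠ q) (hpq : p ≠ q) (hdeg : ∀ i, q ∈ ends i → i = e)
    (hf : Monotone f) (hg : Monotone g) (hfq : ∀ C : Set V, f (insert q C) = f C) (hgq : ∀ C : Set V, g (insert q C) = g C)
    (hQ : 0 ≤ ∑ r ∈ univ.filter (fun r : Finset {j : ι // j ∉ ({e} : Finset ι)} =>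
        ¬ (p ∈ openCluster ((fun j : {j : ι // j ∉ ({e} : Finset ι)} => ends j.1) '' (↑r : Set {j : ι // j ∉ ({e} : Finset ι)})) x ∧
           t ∈ openCluster ((fun j : {j : ι // j ∉ ({e} : Finset ι)} => ends j.1) '' (↑(rᶜ) : Set {j : ι // j ∉ ({e} : Finset ι)})) x)),
      (f (openCluster ((fun j : {j : ι // j ∉ ({e} : Finset ι)} => ends j.1) '' (↑r : Set {j : ι // j ∉ ({e} : Finset ι)})) x) -
          f (openCluster ((fun j : {j : ι // j ∉ ({e} : Finset ι)} => ends j.1) '' (↑(rᶜ) : Set {j : ι // j ∉ ({e} : Finset ι)})) x)) *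
        (g (openCluster ((fun j : {j : ι // j ∉ ({e} : Finset ι)} => ends j.1) '' (↑r : Set {j : ι // j ∉ ({e} : Finset ι)})) x) -
          g (openCluster ((fun j : {j : ι // j ∉ ({e} : Finset ι)} => ends j.1) '' (↑(rᶜ) : Set {j : ι // j ∉ ({e} : Finset ι)})) x))) :
    0 ≤ ∑ s ∈ univ.filter (fun s : Finset ι => ¬ (p ∈ openCluster (ends '' (↑s : Set ι)) x ∧ q ∈ openCluster (ends '' (↑(sᶜ) : Set ι)) x)),
      (f (openCluster (ends '' (↑s : Set ι)) x) - f (openCluster (ends '' (↑(sᶜ) : Set ι)) x)) *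
        (g (openCluster (ends '' (↑s : Set ι)) x) - g (openCluster (ends '' (↑(sᶜ) : Set ι)) x)) := by
  rw [qmix_leaf_snd_eq ends x f g he htq hxq hpq hdeg hfq hgq]
  set ends' : {j : ι // j ∉ ({e} : Finset ι)} → Sym2 V := fun j => ends j.1 with hends'
  have hKmono : ∀ {r r' : Finset {j : ι // j ∉ ({e} : Finset ι)}}, r ⊆ r' →
      openCluster (ends' '' (↑r : Set _)) x ⊆ openCluster (ends' '' (↑r' : Set _)) x := fun hst => openCluster_image_mono ends' hst x
  have hH := harris_twoColouring (fun r : Finset {j : ι // j ∉ ({e} : Finset ι)} => f (openCluster (ends' '' (↑r : Set _)) x))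
    (fun r => g (openCluster (ends' '' (↑r : Set _)) x)) (fun r r' h => hf (hKmono h)) (fun r r' h => hg (hKmono h))
  exact add_nonneg hQ hH

open Classical in
/-- **A leaf of the ROOT (second vertex): `Q_mix(p,q)[f,g] ≥ 0`.**  If `q ∉ {x,p}` is a leaf with anchor `x` and the monotone `f, g` ignore `q`, then `Q_mix(p,q) ≥ 0`:
the anchor exclusion `Q_mix^{G−q}(p,x)` is the off-cluster sum `OFF^{G−q}(p)` (`x ∈ K′ rᶜ` always), nonnegative by gen 23's `offCluster_twoColouring_nonneg`.
(The general-`f,g` version, with `f, g` feeling `q`, is gen 47's `qmix_nonneg_of_rootPendant`.)  [cite: KozmaNitzan2024, Questions 8–9 (§5.5 p. 36) (context)] -/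
theorem qmix_nonneg_of_leaf_snd_root (he : ends e = s(q, x)) (hxq : x ≠ q) (hpq : p ≠ q) (hdeg : ∀ i, q ∈ ends i → i = e)
    (hf : Monotone f) (hg : Monotone g) (hfq : ∀ C : Set V, f (insert q C) = f C) (hgq : ∀ C : Set V, g (insert q C) = g C) :
    0 ≤ ∑ s ∈ univ.filter (fun s : Finset ι => ¬ (p ∈ openCluster (ends '' (↑s : Set ι)) x ∧ q ∈ openCluster (ends '' (↑(sᶜ) : Set ι)) x)),
      (f (openCluster (ends '' (↑s : Set ι)) x) - f (openCluster (ends '' (↑(sᶜ) : Set ι)) x)) *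
        (g (openCluster (ends '' (↑s : Set ι)) x) - g (openCluster (ends '' (↑(sᶜ) : Set ι)) x)) := by
  refine qmix_nonneg_of_leaf_snd ends x f g he hxq hxq hpq hdeg hf hg hfq hgq ?_
  set ends' : {j : ι // j ∉ ({e} : Finset ι)} → Sym2 V := fun j => ends j.1 with hends'
  have hOFF := offCluster_twoColouring_nonneg ends' x ({p} : Set V) f g hf hg
  refine le_of_le_of_eq hOFF (Finset.sum_congr ?_ fun r _ => rfl)
  refine Finset.filter_congr fun r _ => ?_
  simp only [Set.mem_singleton_iff, forall_eq]
  constructor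
  · intro h hpx; exact h hpx.1
  · intro h hp; exact h ⟨hp, mem_openCluster_self _ x⟩

open Classical in
/-- **A leaf hanging at the point (second vertex): `Q_mix(p,q)[1_t, g] ≥ 0`.**  If `q ∉ {x,p}` is a leaf with anchor `t` and `f = 1[t ∈ ·]`, then for every monotone `g`
ignoring `q`: `Q_mix(p,q)[1_t,g] ≥ 0` — the anchor exclusion `Q_mix^{G−q}(p,t)[1_t,g]` is Harris-twice (`qmix_nonneg_of_pointIndicator_right`, gen 48).
[cite: KozmaNitzan2024, Questions 8–9 (§5.5 p. 36) (context)] -/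
theorem qmix_nonneg_of_leaf_snd_point (he : ends e = s(q, t)) (htq : t ≠ q) (hxq : x ≠ q) (hpq : p ≠ q) (hdeg : ∀ i, q ∈ ends i → i = e)
    (hg : Monotone g) (hgq : ∀ C : Set V, g (insert q C) = g C) :
    0 ≤ ∑ s ∈ univ.filter (fun s : Finset ι => ¬ (p ∈ openCluster (ends '' (↑s : Set ι)) x ∧ q ∈ openCluster (ends '' (↑(sᶜ) : Set ι)) x)),
      ((if t ∈ openCluster (ends '' (↑s : Set ι)) x then (1 : ℝ) else 0) - (if t ∈ openCluster (ends '' (↑(sᶜ) : Set ι)) x then (1 : ℝ) else 0)) *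
        (g (openCluster (ends '' (↑s : Set ι)) x) - g (openCluster (ends '' (↑(sᶜ) : Set ι)) x)) := by
  have hfm : Monotone (fun C : Set V => if t ∈ C then (1 : ℝ) else 0) := fun A B hAB => by
    by_cases hA : t ∈ A
    · simp [hA, hAB hA]
    · simp only [hA, if_false]; split_ifs <;> norm_num
  have hfq : ∀ C : Set V, (fun C : Set V => if t ∈ C then (1 : ℝ) else 0) (insert q C) = (fun C : Set V => if t ∈ C then (1 : ℝ) else 0) C :=
    fun C => by simp [Set.mem_insert_iff, htq]
  exact qmix_nonneg_of_leaf_snd ends x (fun C : Set V => if t ∈ C then (1 : ℝ) else 0) g he htq hxq hpq hdeg hfm hg hfq hgq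
    (qmix_nonneg_of_pointIndicator_right (fun j : {j : ι // j ∉ ({e} : Finset ι)} => ends j.1) x p t g hg)

open Classical in
/-- **Leaf reduction (first vertex).**  Let `p ∉ {x, q}` have exactly one edge `e`, with ends `{p, t}`, `t ≠ p`, and let `f, g` ignore `p`.  Then
`Q_mix(p,q)[f,g] = Q_mix^{G−p}(t,q)[f,g] + H^{G−p}[f,g]` — by `qmix_swap` (the exclusion of `(p,q)` is that of `(q,p)` read on the swapped colouring) and `qmix_leaf_snd_eq`.
[cite: KozmaNitzan2024, Questions 8–9 (§5.5 p. 36) (context)] -/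
theorem qmix_nonneg_of_leaf_fst (he : ends e = s(p, t)) (htp : t ≠ p) (hxp : x ≠ p) (hqp : q ≠ p) (hdeg : ∀ i, p ∈ ends i → i = e)
    (hf : Monotone f) (hg : Monotone g) (hfp : ∀ C : Set V, f (insert p C) = f C) (hgp : ∀ C : Set V, g (insert p C) = g C)
    (hQ : 0 ≤ ∑ r ∈ univ.filter (fun r : Finset {j : ι // j ∉ ({e} : Finset ι)} =>
        ¬ (t ∈ openCluster ((fun j : {j : ι // j ∉ ({e} : Finset ι)} => ends j.1) '' (↑r : Set {j : ι // j ∉ ({e} : Finset ι)})) x ∧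
           q ∈ openCluster ((fun j : {j : ι // j ∉ ({e} : Finset ι)} => ends j.1) '' (↑(rᶜ) : Set {j : ι // j ∉ ({e} : Finset ι)})) x)),
      (f (openCluster ((fun j : {j : ι // j ∉ ({e} : Finset ι)} => ends j.1) '' (↑r : Set {j : ι // j ∉ ({e} : Finset ι)})) x) -
          f (openCluster ((fun j : {j : ι // j ∉ ({e} : Finset ι)} => ends j.1) '' (↑(rᶜ) : Set {j : ι // j ∉ ({e} : Finset ι)})) x)) *
        (g (openCluster ((fun j : {j : ι // j ∉ ({e} : Finset ι)} => ends j.1) '' (↑r : Set {j : ι // j ∉ ({e} : Finset ι)})) x) -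
          g (openCluster ((fun j : {j : ι // j ∉ ({e} : Finset ι)} => ends j.1) '' (↑(rᶜ) : Set {j : ι // j ∉ ({e} : Finset ι)})) x))) :
    0 ≤ ∑ s ∈ univ.filter (fun s : Finset ι => ¬ (p ∈ openCluster (ends '' (↑s : Set ι)) x ∧ q ∈ openCluster (ends '' (↑(sᶜ) : Set ι)) x)),
      (f (openCluster (ends '' (↑s : Set ι)) x) - f (openCluster (ends '' (↑(sᶜ) : Set ι)) x)) *
        (g (openCluster (ends '' (↑s : Set ι)) x) - g (openCluster (ends '' (↑(sᶜ) : Set ι)) x)) := by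
  -- swap the roles of p and q on both levels
  rw [qmix_swap ends x p q (fun a b => (f a - f b) * (g a - g b)) (fun a b => by ring)]
  refine qmix_nonneg_of_leaf_snd ends x f g he htp hxp hqp hdeg hf hg hfp hgp ?_
  rw [qmix_swap (fun j : {j : ι // j ∉ ({e} : Finset ι)} => ends j.1) x q t (fun a b => (f a - f b) * (g a - g b)) (fun a b => by ring)]
  exact hQ

end leaf

end Coefficientwise

end Summit.CriticalPhenomena.PercolationContinuityZ3.Theorems
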